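import Summits.BirchSwinnertonDyer.BirchSwinnertonDyer.Theses.QuadraticBranchSignedControl
import Summits.BirchSwinnertonDyer.Rank1Residual.Additive.QuadraticBranchEvenReadingsOfEta
import Summits.BirchSwinnertonDyer.Rank1Residual.Additive.CyclotomicTowerSignedSelmerEtaSummand
import HarnessLib

/-!
# Route `QuadraticBranchSignedControl` (rung K8, cell `bsd-potss`): the sign item (R2⁺)
# `NoFiniteSubmodulePlus` (stmt-BirchSwinnertonDyer-19222) from the frame of Kitajima–Otsuki 2018
# Main Thm. 1.3 / Remark 1.4 (5) on the WHOLE plus dual `X⁺(V/ℚ(μ_{p^∞}))` — the reading flag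
# `KO18-eta-summand` of the `η`-component frame REMOVED (discharged in the kernel by
# `EtaSignedSelmerDualData.forall_finite_eq_bot_of_tower`)

HONEST FRAMING (cell `bsd-potss`, run/shared/lean/pub/bsd-potss/; FULL-BSD rank ≤ 1 programme,
tranche 1b): CONDITIONAL RESULTS — the hypotheses `hKO` / `h22` are verbatim-shape frames of
PRINTED theorems on the cell's `Γ_ℚ`-internal object `TowerSignedSelmerDualData V κ K₀ ℚ_[p] γ 1`
(= "`Sel⁺(F_∞, E[p^∞])^∨` as a `Λ = ℤ_p[[Gal(F_∞/F_0)]]`-module", `F = ℚ`, `F_0 = K₀ = ℚ(μ_p)`,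
`γ ↔ 1 + X`, Kitajima–Otsuki §4 / Kobayashi Def. 2.1, Thm. 2.2): `hKO` = Kitajima–Otsuki Main
Thm. 1.3 for `F = ℚ`, sign `+` (with its displayed hypothesis (vi) in `…_of_kobayashi22Tower`, or in
the (vi)-free form of Remark 1.4 (5) "for `E/ℚ`, `a_p = 0` … no nontrivial finite `Λ`-submodule for
any finite abelian `F_0`" in `…_of_kitajimaOtsuki13Tower`); `h22` = Kobayashi Thm. 2.2 (`X⁺(E/K_∞)`
finitely generated `Λ`-torsion). NOTHING about the printed theorems is asserted; no definition, no
named Literature fact, no `sorry`, axioms standard; item 19222 is NOT closed by this file. What it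
records: 19222 ⟸ (KO18 Thm 1.3 + Kobayashi Thm 2.2, both for the WHOLE `X⁺(V/ℚ(μ_{p^∞}))`, `Γ_ℚ`-internally)
— the `η`-summand passage (`p ∤ ♯Δ`, Kobayashi §4 p. 8 `M^η = ε_η M`) is now a tree THEOREM
(`S/Additive/CyclotomicTowerSignedSelmerEtaSummand.lean`), and the transport `X⁺(W/ℚ_∞) =
X⁺(V/K₀ℚ_∞)^η` was already one (ctrl, (D5⁺)). What still separates `hKO` from the Literature fact
`KitajimaOtsuki2018.mainThm13_plusSelmerDual_noFiniteSubmodule` is ONLY the identification of the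
`Γ_ℚ`-internal tower object with the `Γ_{ℚ(μ_p)}`-internal `Kobayashi2003.signedSelmerInfty
(V.baseChange K₀) κ' 1` (ctrl's `subgroupH1Iso` + local-condition matching; not here).

References: [KitajimaOtsuki2018] Main Thm. 1.3 (= Thm. 4.8), Remark 1.4 (5), §4 (arXiv:1607.03612
pp. 3–4, 18–19); [Kobayashi2003] Def. 2.1 and Thm. 2.2 (p. 5), §4 p. 8.
-/

set_option autoImplicit false
set_option linter.dupNamespace false

noncomputable section

open scoped Classical

namespace Summit.BirchSwinnertonDyer.BirchSwinnertonDyer.Theorems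

open WeierstrassCurve Field Literature.NumberTheory.EllipticCurves
  Literature.NumberTheory.GaloisRepresentations ZpExtension
  Summit.BirchSwinnertonDyer.Rank1Residual.Additive
  Summit.BirchSwinnertonDyer.Rank1Residual.Additive.SignedTwist
  Summit.BirchSwinnertonDyer.BirchSwinnertonDyer.Theses.QuadraticBranchSignedControl

/-- **(R2⁺) at a pair `(W, p)` from the frame of Kitajima–Otsuki Main Thm. 1.3 / Remark 1.4 (5)
on the WHOLE plus dual `X⁺(V/K₀ℚ_∞)`** (`K₀ = ℚ(μ_p)`, `Γ_ℚ`-internal `TowerSignedSelmerDualData`,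
no (vi) — Remark 1.4 (5)'s form for `E/ℚ`, `a_p = 0`): `EvenBranchPlusNoFiniteSubmoduleAt W p`.
Proof: ctrl's `evenBranchPlusNoFiniteSubmoduleAt_of_kitajimaOtsuki13PlusEta` with its `η`-frame
DISCHARGED from the full frame by `EtaSignedSelmerDualData.forall_finite_eq_bot_of_tower` (the
`η`-part is a `Λ`-direct summand: `κ` onto on `Gal(ℚ̄/K₀)`, `p ∤ [Γ_ℚ : Gal(ℚ̄/K₀)] = p − 1`, the
full datum exists). CONDITIONAL on `hKO`; nothing asserted.
[cite: KitajimaOtsuki2018, Main Thm. 1.3 and Remark 1.4 (5) (arXiv:1607.03612 pp. 3–4)]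
[cite: Kobayashi2003, §4 p. 8 (M^η = ε_η M), Def. 2.1 (p. 5)] -/
theorem evenBranchPlusNoFiniteSubmoduleAt_of_kitajimaOtsuki13Tower
    (W : WeierstrassCurve ℚ) [W.IsElliptic] [W.IsGloballyMinimal] (p : ℕ) [Fact p.Prime]
    (hKO : ∀ (K₀ : Type) [Field K₀] [NumberField K₀] [IsCyclotomicExtension {p} ℚ K₀]
        [(galRange (K := ℚ) K₀).Normal],
      ∀ (V : WeierstrassCurve ℚ) [V.IsElliptic] [V.IsGloballyMinimal],
        p ≠ 2 → V.HasGoodReductionAtPrime p → V.frobeniusTrace p = 0 →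
      ∀ (κ : ZpExtension ℚ p) (γ : absoluteGaloisGroup ℚ),
        κ.IsCyclotomic → κ.IsTopGenerator γ → γ ∈ galRange (K := ℚ) K₀ →
      ∀ (D : TowerSignedSelmerDualData V κ K₀ ℚ_[p] γ 1),
        ∀ N : Submodule (IwasawaAlgebra p) D.X, Finite N → N = ⊥) :
    EvenBranchPlusNoFiniteSubmoduleAt W p :=
  evenBranchPlusNoFiniteSubmoduleAt_of_kitajimaOtsuki13PlusEta W p
    fun K₀ _ _ _ _ ηq hηK V _ _ hp2 hgood hap κ γ hκ hγ hγK Dη _ _ M hM ↦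
      EtaSignedSelmerDualData.forall_finite_eq_bot_of_tower V κ K₀ ℚ_[p] ηq 1
        (kappa_surjOn_galRange_cyclotomic κ K₀) hγ hγK hηK (coprime_index_galRange_cyclotomic p K₀)
        (towerSignedSelmerDualData V κ K₀ ℚ_[p] 1 (kappa_surjOn_galRange_cyclotomic κ K₀) hγ hγK)
        Dη (hKO K₀ V hp2 hgood hap κ γ hκ hγ hγK _) M hM

/-- **(R2⁺) at a pair from Kitajima–Otsuki Main Thm. 1.3 WITH its hypothesis (vi) and Kobayashi's
Thm. 2.2, both as frames on the WHOLE plus dual `X⁺(V/K₀ℚ_∞)`** (`Γ_ℚ`-internal): `hKO` = "if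
`X⁺` is finitely generated `Λ`-torsion then it has no nontrivial finite `Λ`-submodule" (Main
Thm. 1.3, `F = ℚ`, sign `+`), `h22` = "`X⁺(E/K_∞)` is a finitely generated torsion `Λ`-module"
(Kobayashi Thm. 2.2). CONDITIONAL on both; nothing asserted.
[cite: KitajimaOtsuki2018, Main Thm. 1.3 with (vi) (arXiv:1607.03612 p. 3)]
[cite: Kobayashi2003, Thm. 2.2 (p. 5), §4 p. 8] -/
theorem evenBranchPlusNoFiniteSubmoduleAt_of_kitajimaOtsuki13Tower_of_kobayashi22Tower
    (W : WeierstrassCurve ℚ) [W.IsElliptic] [W.IsGloballyMinimal] (p : ℕ) [Fact p.Prime]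
    (h22 : ∀ (K₀ : Type) [Field K₀] [NumberField K₀] [IsCyclotomicExtension {p} ℚ K₀]
        [(galRange (K := ℚ) K₀).Normal],
      ∀ (V : WeierstrassCurve ℚ) [V.IsElliptic] [V.IsGloballyMinimal],
        p ≠ 2 → V.HasGoodReductionAtPrime p → V.frobeniusTrace p = 0 →
      ∀ (κ : ZpExtension ℚ p) (γ : absoluteGaloisGroup ℚ),
        κ.IsCyclotomic → κ.IsTopGenerator γ → γ ∈ galRange (K := ℚ) K₀ →
      ∀ (D : TowerSignedSelmerDualData V κ K₀ ℚ_[p] γ 1),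
        Module.Finite (IwasawaAlgebra p) D.X ∧ Module.IsTorsion (IwasawaAlgebra p) D.X)
    (hKO : ∀ (K₀ : Type) [Field K₀] [NumberField K₀] [IsCyclotomicExtension {p} ℚ K₀]
        [(galRange (K := ℚ) K₀).Normal],
      ∀ (V : WeierstrassCurve ℚ) [V.IsElliptic] [V.IsGloballyMinimal],
        p ≠ 2 → V.HasGoodReductionAtPrime p → V.frobeniusTrace p = 0 →
      ∀ (κ : ZpExtension ℚ p) (γ : absoluteGaloisGroup ℚ),
        κ.IsCyclotomic → κ.IsTopGenerator γ → γ ∈ galRange (K := ℚ) K₀ →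
      ∀ (D : TowerSignedSelmerDualData V κ K₀ ℚ_[p] γ 1),
        Module.Finite (IwasawaAlgebra p) D.X → Module.IsTorsion (IwasawaAlgebra p) D.X →
        ∀ N : Submodule (IwasawaAlgebra p) D.X, Finite N → N = ⊥) :
    EvenBranchPlusNoFiniteSubmoduleAt W p :=
  evenBranchPlusNoFiniteSubmoduleAt_of_kitajimaOtsuki13Tower W p
    fun K₀ _ _ _ _ V _ _ hp2 hgood hap κ γ hκ hγ hγK D ↦
      hKO K₀ V hp2 hgood hap κ γ hκ hγ hγK D (h22 K₀ V hp2 hgood hap κ γ hκ hγ hγK D).1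
        (h22 K₀ V hp2 hgood hap κ γ hκ hγ hγK D).2

/-- **(R2⁺) `NoFiniteSubmodulePlus` (item stmt-BirchSwinnertonDyer-19222) from the (vi)-free frame
of Kitajima–Otsuki Main Thm. 1.3 / Remark 1.4 (5) on the WHOLE `X⁺(V/ℚ(μ_{p^∞}))`, every `p ≥ 5`**
— flag `KO18-eta-summand` gone. CONDITIONAL on `hKO`; closes nothing.
[cite: KitajimaOtsuki2018, Main Thm. 1.3 and Remark 1.4 (5) (arXiv:1607.03612 pp. 3–4)]
[cite: Kobayashi2003, §4 p. 8, Def. 2.1 (p. 5)] -/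
theorem noFiniteSubmodulePlus_of_kitajimaOtsuki13Tower
    (hKO : ∀ (p : ℕ) [Fact p.Prime], 5 ≤ p →
      ∀ (K₀ : Type) [Field K₀] [NumberField K₀] [IsCyclotomicExtension {p} ℚ K₀]
        [(galRange (K := ℚ) K₀).Normal],
      ∀ (V : WeierstrassCurve ℚ) [V.IsElliptic] [V.IsGloballyMinimal],
        p ≠ 2 → V.HasGoodReductionAtPrime p → V.frobeniusTrace p = 0 →
      ∀ (κ : ZpExtension ℚ p) (γ : absoluteGaloisGroup ℚ),
        κ.IsCyclotomic → κ.IsTopGenerator γ → γ ∈ galRange (K := ℚ) K₀ →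
      ∀ (D : TowerSignedSelmerDualData V κ K₀ ℚ_[p] γ 1),
        ∀ N : Submodule (IwasawaAlgebra p) D.X, Finite N → N = ⊥) :
    NoFiniteSubmodulePlus :=
  fun W _ _ p _ hp5 ↦ evenBranchPlusNoFiniteSubmoduleAt_of_kitajimaOtsuki13Tower W p (hKO p hp5)

/-- **(R2⁺) `NoFiniteSubmodulePlus` (item 19222) from Kitajima–Otsuki Main Thm. 1.3 WITH (vi) and
Kobayashi Thm. 2.2, both framed on the WHOLE `X⁺(V/ℚ(μ_{p^∞}))`, every `p ≥ 5`.** The two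
hypotheses are, `Γ_ℚ`-internally, EXACTLY the printed statements for `F = ℚ`, sign `+`; what separates
`hKO` from the Literature fact `KitajimaOtsuki2018.mainThm13_plusSelmerDual_noFiniteSubmodule` is the
identification of the `Γ_ℚ`-internal tower object with `Kobayashi2003.signedSelmerInfty (V.baseChange
K₀) κ' 1` (not here). CONDITIONAL; closes nothing.
[cite: KitajimaOtsuki2018, Main Thm. 1.3 with (vi) (arXiv:1607.03612 p. 3)]
[cite: Kobayashi2003, Thm. 2.2 (p. 5), §4 p. 8] -/
theorem noFiniteSubmodulePlus_of_kitajimaOtsuki13Tower_of_kobayashi22Tower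
    (h22 : ∀ (p : ℕ) [Fact p.Prime], 5 ≤ p →
      ∀ (K₀ : Type) [Field K₀] [NumberField K₀] [IsCyclotomicExtension {p} ℚ K₀]
        [(galRange (K := ℚ) K₀).Normal],
      ∀ (V : WeierstrassCurve ℚ) [V.IsElliptic] [V.IsGloballyMinimal],
        p ≠ 2 → V.HasGoodReductionAtPrime p → V.frobeniusTrace p = 0 →
      ∀ (κ : ZpExtension ℚ p) (γ : absoluteGaloisGroup ℚ),
        κ.IsCyclotomic → κ.IsTopGenerator γ → γ ∈ galRange (K := ℚ) K₀ →
      ∀ (D : TowerSignedSelmerDualData V κ K₀ ℚ_[p] γ 1),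
        Module.Finite (IwasawaAlgebra p) D.X ∧ Module.IsTorsion (IwasawaAlgebra p) D.X)
    (hKO : ∀ (p : ℕ) [Fact p.Prime], 5 ≤ p →
      ∀ (K₀ : Type) [Field K₀] [NumberField K₀] [IsCyclotomicExtension {p} ℚ K₀]
        [(galRange (K := ℚ) K₀).Normal],
      ∀ (V : WeierstrassCurve ℚ) [V.IsElliptic] [V.IsGloballyMinimal],
        p ≠ 2 → V.HasGoodReductionAtPrime p → V.frobeniusTrace p = 0 →
      ∀ (κ : ZpExtension ℚ p) (γ : absoluteGaloisGroup ℚ),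
        κ.IsCyclotomic → κ.IsTopGenerator γ → γ ∈ galRange (K := ℚ) K₀ →
      ∀ (D : TowerSignedSelmerDualData V κ K₀ ℚ_[p] γ 1),
        Module.Finite (IwasawaAlgebra p) D.X → Module.IsTorsion (IwasawaAlgebra p) D.X →
        ∀ N : Submodule (IwasawaAlgebra p) D.X, Finite N → N = ⊥) :
    NoFiniteSubmodulePlus :=
  fun W _ _ p _ hp5 ↦
    evenBranchPlusNoFiniteSubmoduleAt_of_kitajimaOtsuki13Tower_of_kobayashi22Tower W p (h22 p hp5)
      (hKO p hp5)

end Summit.BirchSwinnertonDyer.BirchSwinnertonDyer.Theorems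

end
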